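/-
Copyright (c) 2026 the pub-hodgecm-mathlib formalisation cell (harness21).  Prover seat hodgecm-mathlib-LH4-p06 (g3): Track A «(D-RAM) FOUR-FRAME» squad of crux H413, unit
U3_Laws, (KMS) road «MODULO κ-STAGE B», brick κB-H «CORE-HANGING κ-SOCKETS» FILE (B1a) «CHARACTER MAPS» (dealer LH4-plan (g11) WORDS #34∕#43), 2026-09-04.
-/
import Literature.NumberTheory.LocalFields.WildQuadraticDatumNormSignConductor              -- ★ p856540 (this seat): the ω-conductor toolkit (§3 `normSign_eq_of_near`, §4 `normSign_mul_of_fixed`, §5 the two character-sum lemmas)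
import Summits.HodgeConjecture.HodgeConjecture.Theorems.F0P3cDyRamFixedCountDiagonalModel    -- ★ `normSign_mul_norm` (`ω(x·zσz) = ω(x)`)
import Mathlib.Data.Fin.VecNotation
import Mathlib.Algebra.BigOperators.Finprod
import Mathlib.Data.Set.Card
import HarnessLib

/-!
# Crux `H413`, (KMS) ROAD «MODULO κ-STAGE B», brick κB-H FILE (B1a): THE TWO INVOLUTIONS OF THE ADMISSIBLE UNITS AND THE CHARACTER-SUM WRAPPERS (tools of FILE (B1b))

Cell `hodgecm-mathlib` (D-0151), FLOOR 0, crux item H413 = `stmt-HodgeConjecture-24833`; lane `--supports stmt-HodgeConjecture-24833 --as helper` (count-neutral).  THEOREMS ONLY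
(no `def`, no instance, no notation, no `sorry`, default heartbeats).  Interface letter `LETTER-kappaBH-B1B2-interface.v1.LH4p06g3.md` fcf05c88590d5f17 §1.

THE MATHEMATICS (LH4-p06 (g3) head letter da173de2 (F3)).  By FILE (A2) the κ-count of the core-hanging lattice with exact invariant `g` (a fixed unit with `|1+g| = 1`) is
`[2d−1 ≤ ρ]·χ^H_i(g)` with `(χ^H_0, χ^H_1, χ^H_2)(g) = (ω(−(1+g)), ω(g)ω(−(1+g)), ω(g))`.  FILE (B2) (LH4-p08 (g3)) sums this over the classes `g ∈ R` of a complete irredundant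
system `R` of representatives of the fixed units modulo `𝔭^ρ` (★ `exists_fixed_class_representatives … ρ 0`); FILE (B1b) `…KappaCoreHangingCharacterSums` evaluates the
resulting CHARACTER SUMS with the tools of this file (§1 the involutions `g ↦ −(1+g)`, `g ↦ −g∕(1+g)` and `ω` along them; §2 the toolkit §5 wrappers; §3 transport of
representative systems along the involutions):
* (T1) TUBE, `2d−1 ≤ ρ`: `Σ_{g ∈ R, |1+g| = 1} χ^H_i(g) = 0` for each `i` — the maps `g ↦ −(1+g)` and `g ↦ −g∕(1+g)` are isometric involutions of the admissible fixed units
  `{g : |g| = |1+g| = 1}` with `ω(−(1+g)) = ω∘(g ↦ −(1+g))`, `ω(g)ω(−(1+g)) = ω(−g∕(1+g))` (`ω` multiplicative, `(1+g)²` a norm), so each sum is a full sum `Σ_S ω` over a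
  complete irredundant system of representatives of the admissible units, which vanishes (toolkit §5: the break-level non-norm `c ∈ U_F(2d−2)` acts on the classes and flips `ω`);
* (T2a) GLUE BALL `{g : |g + g₀| ≤ |ϖ|^e}` (`|g₀| = |1−g₀| = 1`, `1 ≤ e ≤ ρ`), `e ≤ 2d−2`: the same three sums vanish (the ball is `U_F(2d−2)`-stable, same involutions);
* (T2b) GLUE BALL with `2d−1 ≤ e`: `ω` is constant on the ball (toolkit §3), so the sum is `#·χ^H_i(f₀)` for any fixed `f₀` in it.
HONEST LABEL.  Count-neutral; `HC_CM` is proved only modulo the 7 printed citations (2 remaining named inputs: hLiu418 = `stmt-HodgeConjecture-24832`, h413 = `stmt-HodgeConjecture-24833`)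
until rung 0 closes.

## References
* [Kottwitz1986BaseChangeUnits] R. Kottwitz, *Base change for unit elements of Hecke algebras*, Compositio Math. 60 (1986), §1 pp. 240–241 (κ-orbital integrals as signed lattice counts).
* [Rogawski1990] J. D. Rogawski, *Automorphic Representations of Unitary Groups in Three Variables*, Ann. of Math. Stud. 123 (1990), §4.9 Prop. 4.9.1 (a) p. 55; §4.10 p. 58.
* [Serre1979] J.-P. Serre, *Local Fields*, GTM 67 (1979), Ch. V §3 Cor. 3 (p. 85), Ch. XV §2 (the norm groups and the conductor of the quadratic character).
-/

set_option autoImplicit false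

noncomputable section

namespace Summit.HodgeConjecture.HodgeConjecture.Cruxes.H413.F0P3cDyRamDiagonalKappaCoreHangingCharacterMaps

open WithZero Matrix
open Literature.NumberTheory.Automorphic.UnitaryThreeFourFrame
open Literature.NumberTheory.LocalFields.WildQuadraticDatum
open Summit.HodgeConjecture.HodgeConjecture.Cruxes.H413.F0P3cDyRamFixedCountDiagonalModel (normSign_mul_norm)
open scoped Valued

variable {K : Type} [Field K] [Valued K ℤᵐ⁰]

/-! ## §0 Valuation letters -/

/-- `|a| = 1` and `|e| < 1` give `|a + e| = 1`. [cite: Serre1979, Ch. XV §2] -/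
theorem v_add_eq_one_of_lt {a e : K} (ha : Valued.v a = 1) (he : Valued.v e < 1) : Valued.v (a + e) = 1 := by
  rw [Valuation.map_add_eq_of_lt_left _ (by rw [ha]; exact he), ha]

/-- The `U_F(2d−2)`-letter: for `d ≥ 2`, a unit `a` with `|a − 1| ≤ exp(−2(d−1))` has `|(a − 1)·x| < 1` for every `|x| = 1`. [cite: Serre1979, Ch. XV §2] -/
theorem v_sub_one_mul_lt_one {d : ℕ} (hd2 : 2 ≤ d) {a x : K} (ha : Valued.v (a - 1) ≤ exp (-(2 * ((d - 1 : ℕ) : ℤ)))) (hx : Valued.v x = 1) :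
    Valued.v ((a - 1) * x) < 1 := by
  rw [map_mul, hx, mul_one]
  refine ha.trans_lt ?_
  rw [← exp_zero, exp_lt_exp]; omega

/-! ## §1 The two involutions `g ↦ −(1+g)` and `g ↦ −g∕(1+g)` of the admissible units, and `ω` along them -/

omit [Valued K ℤᵐ⁰] in
/-- `−(1+g) − (−(1+g′)) = −(g − g′)`: the first involution is an isometry. [cite: Kottwitz1986BaseChangeUnits, §1 pp. 240–241] -/
theorem neg_one_add_sub_neg_one_add (g g' : K) : -(1 + g) - -(1 + g') = -(g - g') := by ring

omit [Valued K ℤᵐ⁰] in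
/-- `−a∕(1+a) − (−b∕(1+b)) = −(a − b)∕((1+a)(1+b))`. [cite: Kottwitz1986BaseChangeUnits, §1 pp. 240–241] -/
theorem moebius_sub_moebius {a b : K} (ha : 1 + a ≠ 0) (hb : 1 + b ≠ 0) :
    -a / (1 + a) - -b / (1 + b) = -(a - b) / ((1 + a) * (1 + b)) := by
  field_simp
  ring

omit [Valued K ℤᵐ⁰] in
/-- `1 + (−a∕(1+a)) = (1+a)⁻¹`. [cite: Kottwitz1986BaseChangeUnits, §1 pp. 240–241] -/
theorem one_add_moebius {a : K} (ha : 1 + a ≠ 0) : 1 + -a / (1 + a) = (1 + a)⁻¹ := by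
  field_simp
  ring

omit [Valued K ℤᵐ⁰] in
/-- The second map is an involution: `−(−a∕(1+a))∕(1 + (−a∕(1+a))) = a`. [cite: Kottwitz1986BaseChangeUnits, §1 pp. 240–241] -/
theorem moebius_moebius {a : K} (ha : 1 + a ≠ 0) : -(-a / (1 + a)) / (1 + -a / (1 + a)) = a := by
  rw [one_add_moebius ha]
  field_simp

/-- Valuation letters of `−a∕(1+a)` for an admissible unit `a` (`|a| = |1+a| = 1`): it is a unit, `|1 + (−a∕(1+a))| = 1`, and the map is isometric on admissible units.
[cite: Kottwitz1986BaseChangeUnits, §1 pp. 240–241] -/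
theorem v_moebius {a : K} (ha : Valued.v a = 1) (h1a : Valued.v (1 + a) = 1) :
    Valued.v (-a / (1 + a)) = 1 ∧ Valued.v (1 + -a / (1 + a)) = 1 := by
  have h1a0 : 1 + a ≠ 0 := fun h => by rw [h, map_zero] at h1a; exact zero_ne_one h1a
  refine ⟨by rw [map_div₀, Valuation.map_neg, ha, h1a, div_one], by rw [one_add_moebius h1a0, map_inv₀, h1a, inv_one]⟩

/-- Isometry of the second map on admissible units: `|−a∕(1+a) − (−b∕(1+b))| = |a − b|`. [cite: Kottwitz1986BaseChangeUnits, §1 pp. 240–241] -/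
theorem v_moebius_sub_moebius {a b : K} (h1a : Valued.v (1 + a) = 1) (h1b : Valued.v (1 + b) = 1) :
    Valued.v (-a / (1 + a) - -b / (1 + b)) = Valued.v (a - b) := by
  have h1a0 : 1 + a ≠ 0 := fun h => by rw [h, map_zero] at h1a; exact zero_ne_one h1a
  have h1b0 : 1 + b ≠ 0 := fun h => by rw [h, map_zero] at h1b; exact zero_ne_one h1b
  rw [moebius_sub_moebius h1a0 h1b0, map_div₀, Valuation.map_neg, map_mul, h1a, h1b, mul_one, div_one]

/-- **`ω(g)·ω(−(1+g)) = ω(−g∕(1+g))`** for a fixed admissible unit `g` (ω multiplicative on fixed scalars, toolkit §4; `g·(−(1+g)) = (−g∕(1+g))·(1+g)σ(1+g)` and `(1+g)σ(1+g)`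
is a norm). [cite: Rogawski1990, §4.10 p. 58] [cite: Serre1979, Ch. XV §2] -/
theorem normSign_mul_normSign_neg_one_add [CompleteSpace K] [Finite 𝓀[K]] {σ : K →+* K} {ϖ : K} {d t : ℕ} (hD : IsRamifiedQuadraticDatum σ ϖ d t)
    {g : K} (hσg : σ g = g) (hg : Valued.v g = 1) (h1g : Valued.v (1 + g) = 1) :
    normSign σ g * normSign σ (-(1 + g)) = normSign σ (-g / (1 + g)) := by
  have hg0 : g ≠ 0 := fun h => by rw [h, map_zero] at hg; exact zero_ne_one hg
  have h1g0 : 1 + g ≠ 0 := fun h => by rw [h, map_zero] at h1g; exact zero_ne_one h1g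
  have hσ1g : σ (1 + g) = 1 + g := by rw [map_add, map_one, hσg]
  rw [← normSign_mul_of_fixed hD hσg (by rw [map_neg, hσ1g]) hg0 (neg_ne_zero.2 h1g0),
    show g * -(1 + g) = -g / (1 + g) * ((1 + g) * σ (1 + g)) by rw [hσ1g]; field_simp,
    normSign_mul_norm σ _ h1g0]

/-! ## §2 Two wrappers of the toolkit's character-sum lemma: admissible units, and a ball of radius `|ϖ|^e`, `e ≤ 2d−2` -/

/-- **`Σ_S ω = 0` over a complete irredundant system `S` of representatives modulo `𝔭^ρ` (`ρ ≥ 2d−1`) of the ADMISSIBLE fixed units `{g : |g| = |1+g| = 1}`** (a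
`U_F(2d−2)`-stable set; toolkit §5). [cite: Serre1979, Ch. V §3 Cor. 3; Ch. XV §2] [cite: Kottwitz1986BaseChangeUnits, §1 pp. 240–241] -/
theorem sum_normSign_eq_zero_of_repr_admissible [CompleteSpace K] [Finite 𝓀[K]] {σ : K →+* K} {ϖ : K} {d t : ℕ}
    (hD : IsRamifiedQuadraticDatum σ ϖ d t) (h2 : Valued.v (2 : K) < 1) {ρ : ℕ} (hρ : 2 * d - 1 ≤ ρ) (S : Finset K)
    (hS1 : ∀ g ∈ S, σ g = g ∧ Valued.v g = 1 ∧ Valued.v (1 + g) = 1)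
    (hS2 : ∀ f : K, σ f = f → Valued.v f = 1 → Valued.v (1 + f) = 1 → ∃ g ∈ S, Valued.v (f - g) ≤ Valued.v ϖ ^ ρ)
    (hS3 : ∀ g ∈ S, ∀ g' ∈ S, Valued.v (g - g') ≤ Valued.v ϖ ^ ρ → g = g') :
    ∑ g ∈ S, normSign σ g = 0 := by
  -- at a wild place `d ≥ 2` (an odd `d` is `t + 1`, ★ `eq_succ_of_odd`, and `|2| = |ϖ|^t < 1` forces `t ≥ 1`)
  have hd2 : 2 ≤ d := by
    obtain ⟨hσ, -, hϖ, hfix, hd, hd1, ht⟩ := hD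
    by_contra hlt
    have h1 : d = 1 := by omega
    subst h1
    have h01 := eq_succ_of_odd hσ hfix hϖ hd ht ⟨0, by norm_num⟩
    rw [ht, show t = 0 by omega, pow_zero] at h2
    exact lt_irrefl _ h2
  refine sum_normSign_repr_eq_zero hD h2 hρ (A := {f : K | σ f = f ∧ Valued.v f = 1 ∧ Valued.v (1 + f) = 1})
    (fun f hf => ⟨hf.1, hf.2.1⟩) ?_ S (fun g hg => hS1 g hg) (fun f hf => hS2 f hf.1 hf.2.1 hf.2.2) hS3
  rintro f ⟨hσf, hf, h1f⟩ a hσa ha ha1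
  refine ⟨by rw [map_mul, hσa, hσf], by rw [map_mul, ha, hf, one_mul], ?_⟩
  rw [show 1 + a * f = (1 + f) + (a - 1) * f by ring]
  exact v_add_eq_one_of_lt h1f (v_sub_one_mul_lt_one hd2 ha1 hf)

/-- **`Σ_S ω = 0` over a complete irredundant system `S` of representatives modulo `𝔭^ρ` (`ρ ≥ 2d−1`) of the fixed units in a BALL `{g : |g − c₀| ≤ |ϖ|^e}`, `|c₀| = 1`,
`e ≤ 2d−2`** (then the ball is `U_F(2d−2)`-stable; toolkit §5). [cite: Serre1979, Ch. V §3 Cor. 3; Ch. XV §2] [cite: Kottwitz1986BaseChangeUnits, §1 pp. 240–241] -/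
theorem sum_normSign_eq_zero_of_repr_ball [CompleteSpace K] [Finite 𝓀[K]] {σ : K →+* K} {ϖ : K} {d t : ℕ}
    (hD : IsRamifiedQuadraticDatum σ ϖ d t) (h2 : Valued.v (2 : K) < 1) {ρ : ℕ} (hρ : 2 * d - 1 ≤ ρ) {c₀ : K} (hc₀ : Valued.v c₀ = 1)
    {e : ℕ} (hed : e ≤ 2 * d - 2) (S : Finset K)
    (hS1 : ∀ g ∈ S, σ g = g ∧ Valued.v g = 1 ∧ Valued.v (g - c₀) ≤ Valued.v ϖ ^ e)
    (hS2 : ∀ f : K, σ f = f → Valued.v f = 1 → Valued.v (f - c₀) ≤ Valued.v ϖ ^ e → ∃ g ∈ S, Valued.v (f - g) ≤ Valued.v ϖ ^ ρ)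
    (hS3 : ∀ g ∈ S, ∀ g' ∈ S, Valued.v (g - g') ≤ Valued.v ϖ ^ ρ → g = g') :
    ∑ g ∈ S, normSign σ g = 0 := by
  have hϖ := hD.2.2.1
  have hball : exp (-(2 * ((d - 1 : ℕ) : ℤ))) ≤ Valued.v ϖ ^ e := by rw [v_varpi_pow hϖ, exp_le_exp]; omega
  refine sum_normSign_repr_eq_zero hD h2 hρ (A := {f : K | σ f = f ∧ Valued.v f = 1 ∧ Valued.v (f - c₀) ≤ Valued.v ϖ ^ e})
    (fun f hf => ⟨hf.1, hf.2.1⟩) ?_ S (fun g hg => hS1 g hg) (fun f hf => hS2 f hf.1 hf.2.1 hf.2.2) hS3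
  rintro f ⟨hσf, hf, hfc⟩ a hσa ha ha1
  refine ⟨by rw [map_mul, hσa, hσf], by rw [map_mul, ha, hf, one_mul], ?_⟩
  rw [show a * f - c₀ = a * (f - c₀) + (a - 1) * c₀ by ring]
  refine Valuation.map_add_le _ (by rw [map_mul, ha, one_mul]; exact hfc) ?_
  rw [map_mul, hc₀, mul_one]; exact ha1.trans hball

/-! ## §3 Transport of a representative system along the two involutions -/

/-- The image of an admissible representative system under `g ↦ −(1+g)` is again one. [cite: Kottwitz1986BaseChangeUnits, §1 pp. 240–241] -/
theorem repr_admissible_image_neg_one_add [DecidableEq K] {σ : K →+* K} {ϖ : K} {ρ : ℕ} (S : Finset K)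
    (hS1 : ∀ g ∈ S, σ g = g ∧ Valued.v g = 1 ∧ Valued.v (1 + g) = 1)
    (hS2 : ∀ f : K, σ f = f → Valued.v f = 1 → Valued.v (1 + f) = 1 → ∃ g ∈ S, Valued.v (f - g) ≤ Valued.v ϖ ^ ρ)
    (hS3 : ∀ g ∈ S, ∀ g' ∈ S, Valued.v (g - g') ≤ Valued.v ϖ ^ ρ → g = g') :
    (∀ h ∈ S.image (fun g => -(1 + g)), σ h = h ∧ Valued.v h = 1 ∧ Valued.v (1 + h) = 1) ∧
    (∀ f : K, σ f = f → Valued.v f = 1 → Valued.v (1 + f) = 1 → ∃ h ∈ S.image (fun g => -(1 + g)), Valued.v (f - h) ≤ Valued.v ϖ ^ ρ) ∧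
    (∀ h ∈ S.image (fun g => -(1 + g)), ∀ h' ∈ S.image (fun g => -(1 + g)), Valued.v (h - h') ≤ Valued.v ϖ ^ ρ → h = h') := by
  classical
  refine ⟨?_, ?_, ?_⟩
  · intro h hh
    obtain ⟨g, hg, rfl⟩ := Finset.mem_image.1 hh
    obtain ⟨hσg, hvg, h1g⟩ := hS1 g hg
    exact ⟨by rw [map_neg, map_add, map_one, hσg], by rw [Valuation.map_neg, h1g],
      by rw [show (1 : K) + -(1 + g) = -g by ring, Valuation.map_neg, hvg]⟩
  · intro f hσf hf h1f
    obtain ⟨g, hg, hfg⟩ := hS2 (-(1 + f)) (by rw [map_neg, map_add, map_one, hσf]) (by rw [Valuation.map_neg, h1f])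
      (by rw [show (1 : K) + -(1 + f) = -f by ring, Valuation.map_neg, hf])
    refine ⟨-(1 + g), Finset.mem_image_of_mem _ hg, ?_⟩
    rw [show f - -(1 + g) = -(-(1 + f) - g) by ring, Valuation.map_neg]; exact hfg
  · intro h hh h' hh' hle
    obtain ⟨g, hg, rfl⟩ := Finset.mem_image.1 hh
    obtain ⟨g', hg', rfl⟩ := Finset.mem_image.1 hh'
    rw [neg_one_add_sub_neg_one_add, Valuation.map_neg] at hle
    rw [hS3 g hg g' hg' hle]

/-- The image of an admissible representative system under `g ↦ −g∕(1+g)` is again one. [cite: Kottwitz1986BaseChangeUnits, §1 pp. 240–241] -/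
theorem repr_admissible_image_moebius [DecidableEq K] {σ : K →+* K} {ϖ : K} {ρ : ℕ} (S : Finset K)
    (hS1 : ∀ g ∈ S, σ g = g ∧ Valued.v g = 1 ∧ Valued.v (1 + g) = 1)
    (hS2 : ∀ f : K, σ f = f → Valued.v f = 1 → Valued.v (1 + f) = 1 → ∃ g ∈ S, Valued.v (f - g) ≤ Valued.v ϖ ^ ρ)
    (hS3 : ∀ g ∈ S, ∀ g' ∈ S, Valued.v (g - g') ≤ Valued.v ϖ ^ ρ → g = g') :
    (∀ h ∈ S.image (fun g => -g / (1 + g)), σ h = h ∧ Valued.v h = 1 ∧ Valued.v (1 + h) = 1) ∧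
    (∀ f : K, σ f = f → Valued.v f = 1 → Valued.v (1 + f) = 1 → ∃ h ∈ S.image (fun g => -g / (1 + g)), Valued.v (f - h) ≤ Valued.v ϖ ^ ρ) ∧
    (∀ h ∈ S.image (fun g => -g / (1 + g)), ∀ h' ∈ S.image (fun g => -g / (1 + g)), Valued.v (h - h') ≤ Valued.v ϖ ^ ρ → h = h') := by
  classical
  refine ⟨?_, ?_, ?_⟩
  · intro h hh
    obtain ⟨g, hg, rfl⟩ := Finset.mem_image.1 hh
    obtain ⟨hσg, hvg, h1g⟩ := hS1 g hg
    exact ⟨by rw [map_div₀, map_neg, map_add, map_one, hσg], (v_moebius hvg h1g).1, (v_moebius hvg h1g).2⟩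
  · intro f hσf hf h1f
    have h1f0 : 1 + f ≠ 0 := fun h => by rw [h, map_zero] at h1f; exact zero_ne_one h1f
    obtain ⟨hvpf, h1pf⟩ := v_moebius hf h1f
    obtain ⟨g, hg, hfg⟩ := hS2 (-f / (1 + f)) (by rw [map_div₀, map_neg, map_add, map_one, hσf]) hvpf h1pf
    refine ⟨-g / (1 + g), Finset.mem_image_of_mem _ hg, ?_⟩
    have e : f - -g / (1 + g) = -(-f / (1 + f)) / (1 + -f / (1 + f)) - -g / (1 + g) := by rw [moebius_moebius h1f0]
    rw [e, v_moebius_sub_moebius h1pf (hS1 g hg).2.2]; exact hfg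
  · intro h hh h' hh' hle
    obtain ⟨g, hg, rfl⟩ := Finset.mem_image.1 hh
    obtain ⟨g', hg', rfl⟩ := Finset.mem_image.1 hh'
    rw [v_moebius_sub_moebius (hS1 g hg).2.2 (hS1 g' hg').2.2] at hle
    rw [hS3 g hg g' hg' hle]

/-- The image of a BALL representative system (`|g − c₀| ≤ |ϖ|^e`) under `g ↦ −(1+g)` is a ball representative system around `−(1+c₀)`. [cite: Kottwitz1986BaseChangeUnits, §1 pp. 240–241] -/
theorem repr_ball_image_neg_one_add [DecidableEq K] {σ : K →+* K} {ϖ : K} {ρ e : ℕ} {c₀ : K} (hc₀ : Valued.v c₀ = 1) (h1c₀ : Valued.v (1 + c₀) = 1)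
    (he : Valued.v ϖ ^ e < 1) (S : Finset K)
    (hS1 : ∀ g ∈ S, σ g = g ∧ Valued.v g = 1 ∧ Valued.v (g - c₀) ≤ Valued.v ϖ ^ e)
    (hS2 : ∀ f : K, σ f = f → Valued.v f = 1 → Valued.v (f - c₀) ≤ Valued.v ϖ ^ e → ∃ g ∈ S, Valued.v (f - g) ≤ Valued.v ϖ ^ ρ)
    (hS3 : ∀ g ∈ S, ∀ g' ∈ S, Valued.v (g - g') ≤ Valued.v ϖ ^ ρ → g = g') :
    (∀ h ∈ S.image (fun g => -(1 + g)), σ h = h ∧ Valued.v h = 1 ∧ Valued.v (h - -(1 + c₀)) ≤ Valued.v ϖ ^ e) ∧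
    (∀ f : K, σ f = f → Valued.v f = 1 → Valued.v (f - -(1 + c₀)) ≤ Valued.v ϖ ^ e →
        ∃ h ∈ S.image (fun g => -(1 + g)), Valued.v (f - h) ≤ Valued.v ϖ ^ ρ) ∧
    (∀ h ∈ S.image (fun g => -(1 + g)), ∀ h' ∈ S.image (fun g => -(1 + g)), Valued.v (h - h') ≤ Valued.v ϖ ^ ρ → h = h') := by
  classical
  -- in the ball `|1 + g| = 1`
  have h1 : ∀ g : K, Valued.v (g - c₀) ≤ Valued.v ϖ ^ e → Valued.v (1 + g) = 1 := fun g hg => by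
    rw [show 1 + g = (1 + c₀) + (g - c₀) by ring]; exact v_add_eq_one_of_lt h1c₀ (hg.trans_lt he)
  refine ⟨?_, ?_, ?_⟩
  · intro h hh
    obtain ⟨g, hg, rfl⟩ := Finset.mem_image.1 hh
    obtain ⟨hσg, -, hgc⟩ := hS1 g hg
    exact ⟨by rw [map_neg, map_add, map_one, hσg], by rw [Valuation.map_neg, h1 g hgc],
      by rw [neg_one_add_sub_neg_one_add, Valuation.map_neg]; exact hgc⟩
  · intro f hσf _ hfc
    have hfc' : Valued.v (-(1 + f) - c₀) ≤ Valued.v ϖ ^ e := by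
      rw [show -(1 + f) - c₀ = -(f - -(1 + c₀)) by ring, Valuation.map_neg]; exact hfc
    have h1f : Valued.v (1 + f) = 1 := by
      rw [show 1 + f = -c₀ + (f - -(1 + c₀)) by ring]
      exact v_add_eq_one_of_lt (by rw [Valuation.map_neg, hc₀]) (hfc.trans_lt he)
    obtain ⟨g, hg, hfg⟩ := hS2 (-(1 + f)) (by rw [map_neg, map_add, map_one, hσf]) (by rw [Valuation.map_neg, h1f]) hfc'
    refine ⟨-(1 + g), Finset.mem_image_of_mem _ hg, ?_⟩
    rw [show f - -(1 + g) = -(-(1 + f) - g) by ring, Valuation.map_neg]; exact hfg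
  · intro h hh h' hh' hle
    obtain ⟨g, hg, rfl⟩ := Finset.mem_image.1 hh
    obtain ⟨g', hg', rfl⟩ := Finset.mem_image.1 hh'
    rw [neg_one_add_sub_neg_one_add, Valuation.map_neg] at hle
    rw [hS3 g hg g' hg' hle]

/-- The image of a BALL representative system (`|g − c₀| ≤ |ϖ|^e`, `|c₀| = |1 + c₀| = 1`, `|ϖ|^e < 1`) under `g ↦ −g∕(1+g)` is a ball representative system around `−c₀∕(1+c₀)`.
[cite: Kottwitz1986BaseChangeUnits, §1 pp. 240–241] -/
theorem repr_ball_image_moebius [DecidableEq K] {σ : K →+* K} {ϖ : K} {ρ e : ℕ} {c₀ : K} (hc₀ : Valued.v c₀ = 1) (h1c₀ : Valued.v (1 + c₀) = 1) (he : Valued.v ϖ ^ e < 1)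
    (S : Finset K)
    (hS1 : ∀ g ∈ S, σ g = g ∧ Valued.v g = 1 ∧ Valued.v (g - c₀) ≤ Valued.v ϖ ^ e)
    (hS2 : ∀ f : K, σ f = f → Valued.v f = 1 → Valued.v (f - c₀) ≤ Valued.v ϖ ^ e → ∃ g ∈ S, Valued.v (f - g) ≤ Valued.v ϖ ^ ρ)
    (hS3 : ∀ g ∈ S, ∀ g' ∈ S, Valued.v (g - g') ≤ Valued.v ϖ ^ ρ → g = g') :
    (∀ h ∈ S.image (fun g => -g / (1 + g)), σ h = h ∧ Valued.v h = 1 ∧ Valued.v (h - -c₀ / (1 + c₀)) ≤ Valued.v ϖ ^ e) ∧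
    (∀ f : K, σ f = f → Valued.v f = 1 → Valued.v (f - -c₀ / (1 + c₀)) ≤ Valued.v ϖ ^ e →
        ∃ h ∈ S.image (fun g => -g / (1 + g)), Valued.v (f - h) ≤ Valued.v ϖ ^ ρ) ∧
    (∀ h ∈ S.image (fun g => -g / (1 + g)), ∀ h' ∈ S.image (fun g => -g / (1 + g)), Valued.v (h - h') ≤ Valued.v ϖ ^ ρ → h = h') := by
  classical
  have h1c₀0 : 1 + c₀ ≠ 0 := fun h => by rw [h, map_zero] at h1c₀; exact zero_ne_one h1c₀
  -- in the ball `|1 + g| = 1`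
  have h1 : ∀ g : K, Valued.v (g - c₀) ≤ Valued.v ϖ ^ e → Valued.v (1 + g) = 1 := fun g hg => by
    rw [show 1 + g = (1 + c₀) + (g - c₀) by ring]; exact v_add_eq_one_of_lt h1c₀ (hg.trans_lt he)
  obtain ⟨hvpc, h1pc⟩ := v_moebius hc₀ h1c₀
  refine ⟨?_, ?_, ?_⟩
  · intro h hh
    obtain ⟨g, hg, rfl⟩ := Finset.mem_image.1 hh
    obtain ⟨hσg, hvg, hgc⟩ := hS1 g hg
    exact ⟨by rw [map_div₀, map_neg, map_add, map_one, hσg], (v_moebius hvg (h1 g hgc)).1,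
      by rw [v_moebius_sub_moebius (h1 g hgc) h1c₀]; exact hgc⟩
  · intro f hσf hf hfc
    -- `|1 + f| = 1` (ball around the admissible `−c₀∕(1+c₀)`), so `f ↦ −f∕(1+f)` lands in the ball around `c₀`
    have h1f : Valued.v (1 + f) = 1 := by
      rw [show 1 + f = (1 + -c₀ / (1 + c₀)) + (f - -c₀ / (1 + c₀)) by ring]; exact v_add_eq_one_of_lt h1pc (hfc.trans_lt he)
    have h1f0 : 1 + f ≠ 0 := fun h => by rw [h, map_zero] at h1f; exact zero_ne_one h1f
    obtain ⟨hvpf, h1pf⟩ := v_moebius hf h1f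
    have hpfc : Valued.v (-f / (1 + f) - c₀) ≤ Valued.v ϖ ^ e := by
      have e1 : -f / (1 + f) - c₀ = -f / (1 + f) - -(-c₀ / (1 + c₀)) / (1 + -c₀ / (1 + c₀)) := by rw [moebius_moebius h1c₀0]
      rw [e1, v_moebius_sub_moebius h1f h1pc]; exact hfc
    obtain ⟨g, hg, hfg⟩ := hS2 (-f / (1 + f)) (by rw [map_div₀, map_neg, map_add, map_one, hσf]) hvpf hpfc
    refine ⟨-g / (1 + g), Finset.mem_image_of_mem _ hg, ?_⟩
    have e2 : f - -g / (1 + g) = -(-f / (1 + f)) / (1 + -f / (1 + f)) - -g / (1 + g) := by rw [moebius_moebius h1f0]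
    rw [e2, v_moebius_sub_moebius h1pf (h1 g (hS1 g hg).2.2)]; exact hfg
  · intro h hh h' hh' hle
    obtain ⟨g, hg, rfl⟩ := Finset.mem_image.1 hh
    obtain ⟨g', hg', rfl⟩ := Finset.mem_image.1 hh'
    rw [v_moebius_sub_moebius (h1 g (hS1 g hg).2.2) (h1 g' (hS1 g' hg').2.2)] at hle
    rw [hS3 g hg g' hg' hle]

end Summit.HodgeConjecture.HodgeConjecture.Cruxes.H413.F0P3cDyRamDiagonalKappaCoreHangingCharacterMaps

end
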